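import Mathlib
import Summits.RiemannHypothesis.RiemannHypothesis.Theorems.HandoffRealZeroCount
import Summits.RiemannHypothesis.RiemannHypothesis.Theorems.HandoffXiZeroCount
import Summits.RiemannHypothesis.RiemannHypothesis.Theorems.HandoffCountThinReal
import Summits.RiemannHypothesis.RiemannHypothesis.Theorems.HandoffCountThinConverse
import Literature.Analysis.Complex.FourierPolyaKiKimEngine
import Literature.NumberTheory.LFunctions.RiemannXiProofs
import Literature.NumberTheory.LFunctions.ZetaZeros
import Literature.NumberTheory.LFunctions.RHWave0
import Literature.NumberTheory.LFunctions.WeilExplicitFormulaProofs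
import HarnessLib

/-!
# ROUTE R-K «COUNT-AND-THIN»: the conjectures SC-2 `CountLaw` and SC-3 `ThinConvergence`, typed
(idea-3 gen22, TASK H-K1 — statements file)

Handoff track (ROUTE 1′), prove-1 gen13. Source: HOME/handoff/IDEAS-finite-rank.md v3.3.1 PART G22
§G22-3/§G22-4. This is the STATEMENTS file of ROUTE R-K: the two conjuncts of idea-3's (B)-type pair
are typed VERBATIM as predicates on a family `F : ℝ → ℂ → ℂ`, `t ↦ û_t` (for idea-3: the cosine
transform of the `L²`-normalised even Weil ground state on `[-t, t]`), and the implication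
`CountLaw F → ThinConvergence F → RiemannHypothesis` (G22-T) is a short unfolding of
`CountThin.riemannHypothesis_of_count_of_thin` (`HandoffCountThin.lean`, p387072) — here made
self-contained on BUILT modules through `im_eq_zero_of_count_of_thinRect` (evenness + Weierstrass +
the real-axis theorem `HandoffCountThinReal.im_eq_zero_of_count_of_smoothConvergence`).

* SC-2 `CountLaw F`: `∀ T > 0, ∃ t₀, ∀ t ≥ t₀: #{x ∈ (0, T] : û_t(x) = 0} = N(T)`,
  `N(T) = zetaZeroCount T` (the tree's Riemann–von Mangoldt counting function, zeros of `ζ` with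
  `0 < Im ρ ≤ T` counted with multiplicity; the zero count is a `Set.encard`, so «infinitely many
  real zeros» never equals `N(T)`).
* SC-3 `ThinConvergence F`: `∃ δ ∈ (0, 1/2), ∃ α β : ℝ → ℝ, ∀ T > 0: e^{-α_t - β_t s²} û_t(s) → Ξ(s)`
  uniformly on `[0, T] × [-δ, δ]`, `Ξ = riemannXiUpper` (PART G22's Gaussian normaliser; the hand-off
  line's form is `β = 0`). The Gaussian is absorbed into the family (same real zeros), so G22-T applies.
Both are OPEN CONJECTURES about the Weil ground states (idea-3: neither is known to follow from RH;
both are exact, margin-free; parity 6046/6046, count 749/0, thin-strip residual ≤ 7e-10 on certified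
data); `@[conjecture]`-tagged obligation nodes. PLACEMENT (`exists_countLaw_and_thinConvergence_of_
riemannHypothesis`, `riemannHypothesis_of_exists_countLaw_and_thinConvergence`): the existential form
of the criterion lies between `RH ∧ SimpleZerosConjecture` (witness: the constant family `û_t := Ξ`)
and `RH`. GIVEN THIN, COUNT IS RH (`riemannHypothesis_of_countLaw_offOrdinates_of_thinConvergence`,
`countLaw_offOrdinates_of_riemannHypothesis`, via `HandoffCountThinConverse.count_of_nhds_of_
riemannHypothesis`): for a family with `ThinConvergence`, the count law at the non-ordinate heights
implies `RH` and is implied by `RH ∧ SimpleZerosConjecture`. Nothing here is, or suggests, a proof of RH.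
-/

set_option linter.dupNamespace false  -- the mandated namespace repeats `RiemannHypothesis`

noncomputable section

open Filter Set Topology Metric Complex
open scoped BigOperators
open Literature.NumberTheory.LFunctions Literature.Analysis.Complex.KiKim

namespace Summit.RiemannHypothesis.RiemannHypothesis.Theorems

namespace CountThin

open RealZeroCount

/-- The real zeros of `û_t = F t` in `(0, T]`. -/
def realZeros (F : ℝ → ℂ → ℂ) (t T : ℝ) : Set ℝ := {x | 0 < x ∧ x ≤ T ∧ F t x = 0}

/-- The thin rectangle `[0, T] × [-δ, δ] ⊆ ℂ`. -/
def thinRect (T δ : ℝ) : Set ℂ := Icc 0 T ×ℂ Icc (-δ) δ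


/-! ## One window from a thin rectangle (self-contained route through the built real-axis form) -/

/-- **One window from a thin rectangle.** `û_t = F t` entire, real on `ℝ` and even; real normalisers
`c_t ≠ 0` with `c_t û_t → Ξ` uniformly on a thin rectangle `[0, T'] × [-δ, δ]` (`δ > 0`, `T < T'`,
`0 ≤ T`); SC-2 at `T`. Then every zero of `Ξ` with `0 < Re z ≤ T` is real. (Evenness reflects the
rectangle to a neighbourhood of `[0, T]`; Weierstrass gives `C^k`-convergence on `[0, T]`; then
`im_eq_zero_of_count_of_smoothConvergence`.) -/
theorem im_eq_zero_of_count_of_thinRect {F : ℝ → ℂ → ℂ} (hdiff : ∀ t, Differentiable ℂ (F t))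
    (hreal : ∀ (t : ℝ) (x : ℝ), (F t x).im = 0) (heven : ∀ (t : ℝ) (z : ℂ), F t (-z) = F t z)
    {c : ℝ → ℝ} (hc : ∀ t, c t ≠ 0) {T T' δ : ℝ} (hTT' : T < T') (hT : 0 ≤ T) (hδ : 0 < δ)
    (hC : ∀ᶠ t : ℝ in atTop, (realZeros F t T).encard = (zetaZeroCount T : ℕ∞))
    (hconv : TendstoUniformlyOn (fun t z => ((c t : ℝ) : ℂ) * F t z) riemannXiUpper atTop
      (thinRect T' δ)) :
    ∀ z : ℂ, riemannXiUpper z = 0 → 0 < z.re → z.re ≤ T → z.im = 0 := by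
  set Φ : ℝ → ℂ → ℂ := fun t z => ((c t : ℝ) : ℂ) * F t z with hΦ
  have hΦd : ∀ t, Differentiable ℂ (Φ t) := fun t => (differentiable_const _).mul (hdiff t)
  set R : Set ℂ := thinRect T' δ with hR
  set U : Set ℂ := Ioo (-T') T' ×ℂ Ioo (-δ) δ with hU
  have hUo : IsOpen U := isOpen_Ioo.reProdIm isOpen_Ioo
  have hseg : ∀ x ∈ Icc (0 : ℝ) T, (x : ℂ) ∈ U := fun x hx =>
    mem_reProdIm.mpr ⟨⟨by simp; linarith [hx.1], by simp; linarith [hx.2]⟩, by simp [hδ], by simp [hδ]⟩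
  have h' : TendstoUniformlyOn Φ riemannXiUpper atTop ((fun z : ℂ => -z) ⁻¹' R) := by
    have := hconv.comp (fun z : ℂ => -z)
    have hΦ' : (fun t => Φ t ∘ fun z : ℂ => -z) = Φ := by funext t z; simp [Φ, heven]
    have hΞ : (riemannXiUpper ∘ fun z : ℂ => -z) = riemannXiUpper := by
      funext z; simp [riemannXiUpper_neg]
    rwa [hΦ', hΞ] at this
  have hRU : TendstoUniformlyOn Φ riemannXiUpper atTop (R ∪ (fun z : ℂ => -z) ⁻¹' R) := by
    intro u hu
    filter_upwards [hconv u hu, h' u hu] with n hn hn' x hx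
    exact hx.elim (hn x) (hn' x)
  have hloc : TendstoLocallyUniformlyOn Φ riemannXiUpper atTop U := by
    refine (hRU.mono ?_).tendstoLocallyUniformlyOn
    intro z hz
    obtain ⟨⟨hr1, hr2⟩, hi1, hi2⟩ := mem_reProdIm.mp hz
    rcases le_or_gt 0 z.re with hre | hre
    · exact Or.inl (mem_reProdIm.mpr ⟨⟨hre, hr2.le⟩, hi1.le, hi2.le⟩)
    · exact Or.inr (mem_reProdIm.mpr
        ⟨⟨by simp; exact hre.le, by simp; linarith⟩, by simp; linarith, by simp; linarith⟩)
  set g : ℝ → ℝ → ℝ := fun t x => (Φ t x).re with hg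
  refine im_eq_zero_of_count_of_smoothConvergence (g := g)
    (Eventually.of_forall fun t => contDiff_re_ofReal (hΦd t)) ?_ ?_
  · filter_upwards [hC] with t ht
    have : {x : ℝ | 0 < x ∧ x ≤ T ∧ g t x = 0} = realZeros F t T := by
      ext x
      simp only [mem_setOf_eq, realZeros, g, Φ, Complex.re_ofReal_mul, mul_eq_zero, hc t, false_or]
      constructor
      · rintro ⟨h0, hT, h⟩
        exact ⟨h0, hT, Complex.ext (by simpa using h) (by simpa using hreal t x)⟩
      · rintro ⟨h0, hT, h⟩
        exact ⟨h0, hT, by simp [h]⟩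
    rw [this]; exact ht
  · intro k _
    have := tendstoUniformlyOn_re_iteratedDeriv hUo hΦd hloc hseg k
    rw [iteratedDeriv_re_ofReal differentiable_riemannXiUpper']
    refine this.congr (Eventually.of_forall fun t x _ => ?_)
    change (iteratedDeriv k (Φ t) x).re = iteratedDeriv k (g t) x
    rw [hg, iteratedDeriv_re_ofReal (hΦd t)]

/-- **SC-2 (COUNT LAW)** of idea-3 gen22 (HOME/handoff/IDEAS-finite-rank.md v3.3.1 PART G22 §G22-3),
verbatim: for every `T > 0` there is `t₀` such that for all `t ≥ t₀` the number of real zeros of `û_t`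
in `(0, T]` equals `N(T) = zetaZeroCount T`. An OPEN CONJECTURE about the Weil ground-state family
`t ↦ û_t`; typed as a predicate on an arbitrary family `F`. For the ground states it is not known to
follow from RH alone; GIVEN SC-3 it follows from `RH ∧ SimpleZerosConjecture` at every non-ordinate
`T` (`countLaw_offOrdinates_of_riemannHypothesis`), not at the ordinates. -/
@[conjecture] def CountLaw (F : ℝ → ℂ → ℂ) : Prop :=
  ∀ T : ℝ, 0 < T → ∀ᶠ t : ℝ in atTop, (realZeros F t T).encard = (zetaZeroCount T : ℕ∞)

/-- **SC-3 (THIN CONVERGENCE)** of idea-3 gen22 (HOME/handoff/IDEAS-finite-rank.md v3.3.1 PART G22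
§G22-3), verbatim: there are `δ ∈ (0, 1/2)` and real normalisers `α_t, β_t` such that
`e^{-α_t - β_t s²} û_t(s) → Ξ(s)` uniformly on the thin rectangle `s ∈ [0, T] × [-δ, δ]` for every
`T > 0` (as `t → ∞`; the hand-off line I l.5735 has `β = 0`, PART G22 §G22-3 the Gaussian normaliser
`e^{-β_t s²}` — both are covered). An OPEN CONJECTURE about the Weil ground-state family (Connes's
(M2) restricted to thin rectangles); typed as a predicate on `F`. Not known to follow from RH. -/
@[conjecture] def ThinConvergence (F : ℝ → ℂ → ℂ) : Prop :=
  ∃ δ : ℝ, 0 < δ ∧ δ < 1 / 2 ∧ ∃ α β : ℝ → ℝ, ∀ T : ℝ, 0 < T →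
    TendstoUniformlyOn (fun t z => Complex.exp (-(α t : ℂ) - (β t : ℂ) * z ^ 2) * F t z)
      riemannXiUpper atTop (thinRect T δ)

/-- **THEOREM G22-T, named form** (idea-3 gen22, ROUTE R-K «COUNT-AND-THIN», TASK H-K1): for any
family `t ↦ û_t` of entire functions, real on `ℝ` and even, `CountLaw F → ThinConvergence F →
RiemannHypothesis`. A pure implication between two open conjectures about the Weil ground states
and RH; nothing here is, or suggests, a proof of RH. -/
theorem riemannHypothesis_of_countLaw_of_thinConvergence {F : ℝ → ℂ → ℂ}
    (hdiff : ∀ t, Differentiable ℂ (F t)) (hreal : ∀ (t : ℝ) (x : ℝ), (F t x).im = 0)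
    (heven : ∀ (t : ℝ) (z : ℂ), F t (-z) = F t z)
    (hC : CountLaw F) (hT : ThinConvergence F) : RiemannHypothesis := by
  obtain ⟨δ, hδ, hδ', α, β, hconv⟩ := hT
  -- absorb the Gaussian normaliser into the family: same real zeros, still entire, real and even
  set F' : ℝ → ℂ → ℂ := fun t z => Complex.exp (-(β t : ℂ) * z ^ 2) * F t z with hF'
  have hdiff' : ∀ t, Differentiable ℂ (F' t) := fun t =>
    ((differentiable_const _).mul (differentiable_id.pow 2)).cexp.mul (hdiff t)
  have hreal' : ∀ (t : ℝ) (x : ℝ), (F' t x).im = 0 := by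
    intro t x
    have h1 : Complex.exp (-(β t : ℂ) * (x : ℂ) ^ 2) = ((Real.exp (-(β t) * x ^ 2) : ℝ) : ℂ) := by
      push_cast; ring_nf
    simp only [F', h1, Complex.im_ofReal_mul, hreal t x, mul_zero]
  have heven' : ∀ (t : ℝ) (z : ℂ), F' t (-z) = F' t z := by
    intro t z; simp [F', heven t z]
  have hzeros : ∀ t T, realZeros F' t T = realZeros F t T := by
    intro t T; ext x; simp [F', realZeros, Complex.exp_ne_zero]
  have hconv' : ∀ T : ℝ, 0 < T → TendstoUniformlyOn
      (fun t z => ((Real.exp (-α t) : ℝ) : ℂ) * F' t z) riemannXiUpper atTop (thinRect T δ) := by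
    intro T hT
    refine (hconv T hT).congr (Eventually.of_forall fun t z _ => ?_)
    simp only [F']
    rw [← mul_assoc, Complex.ofReal_exp, ← Complex.exp_add]
    push_cast; ring_nf
  have key : ∀ T : ℝ, 0 < T → ∀ z : ℂ, riemannXiUpper z = 0 → 0 < z.re → z.re ≤ T → z.im = 0 :=
    fun T hT0 => im_eq_zero_of_count_of_thinRect hdiff' hreal' heven' (c := fun t => Real.exp (-α t))
      (fun t => (Real.exp_pos _).ne') (lt_add_one T) hT0.le hδ
      (by simpa only [hzeros] using hC T hT0) (hconv' (T + 1) (by linarith))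
  refine (riemannHypothesis_iff_im_eq_zero_of_riemannXiUpper_eq_zero_holds :
    RiemannHypothesis ↔ _).mpr fun z hz => ?_
  rcases lt_trichotomy z.re 0 with hre | hre | hre
  · have hz' : riemannXiUpper (-z) = 0 := by rw [riemannXiUpper_neg]; exact hz
    have := key ((-z).re) (by simp; linarith) (-z) hz' (by simp; linarith) le_rfl
    simpa using this
  · exact absurd hre (re_ne_zero_of_riemannXiUpper_eq_zero hz)
  · exact key z.re hre z hz hre le_rfl


/-! ## Placement: the criterion sits between `RH` and `RH ∧ simple zeros` -/

/-- Under RH and the simple-zeros conjecture the CONSTANT family `û_t := Ξ` satisfies SC-2: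
`#{x ∈ (0, T] : Ξ(x) = 0} = N(T)` for every `T` (all zeros in the box are real and of analytic order
one; the bridge `sum_analyticOrderNatAt_eq_zetaZeroCount`). Compare `HandoffCountThin`'s
`encard_real_zeros_xi_eq_zetaZeroCount`. -/
theorem countLaw_const_xi (hRH : RiemannHypothesis) (hS : SimpleZerosConjecture) :
    CountLaw (fun _ => riemannXiUpper) := by
  classical
  intro T _
  refine Eventually.of_forall fun _ => ?_
  -- RH-world facts: every zero of `Ξ` is real and simple
  have xi_real : ∀ {z : ℂ}, riemannXiUpper z = 0 → z.im = 0 := fun {z} hz =>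
    ((riemannHypothesis_iff_im_eq_zero_of_riemannXiUpper_eq_zero_holds : RiemannHypothesis ↔ _).mp
      hRH) z hz
  have xi_simple : ∀ {z : ℂ}, riemannXiUpper z = 0 → analyticOrderNatAt riemannXiUpper z = 1 := by
    intro z hz
    obtain ⟨hζ, h0, h1⟩ := zeta_zero_of_riemannXiUpper_eq_zero hz
    set ρ := 1 / 2 + I * z with hρ
    have hρ1 : ρ ≠ 1 := fun h => by rw [h] at h1; simp at h1
    have hder : deriv riemannZeta ρ ≠ 0 :=
      hS ρ (mem_riemannZetaNontrivialZeros_of_riemannXi_eq_zero hz)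
    have hord : analyticOrderAt riemannZeta ρ = 1 :=
      (analyticOn_riemannZeta ρ hρ1).analyticOrderAt_eq_one_of_zero_deriv_ne_zero hζ hder
    have hm : riemannZetaZeroOrder ρ = 1 := by
      rw [riemannZetaZeroOrder, (analyticOn_riemannZeta ρ hρ1).meromorphicOrderAt_eq, hord]; simp
    have := analyticOrderNatAt_riemannXiUpper_eq h0 h1
    rw [hm] at this
    exact_mod_cast this
  set S : Set ℝ := realZeros (fun _ => riemannXiUpper) 0 T with hS'
  have hfin := xiZeros_finite T
  have himg : ((↑) : ℝ → ℂ) '' S = {z : ℂ | riemannXiUpper z = 0 ∧ 0 < z.re ∧ z.re ≤ T} := by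
    ext z
    constructor
    · rintro ⟨x, ⟨hx0, hxT, hx⟩, rfl⟩
      exact ⟨hx, by simpa using hx0, by simpa using hxT⟩
    · rintro ⟨hz, hz0, hzT⟩
      have hzre : ((z.re : ℝ) : ℂ) = z := Complex.ext (by simp) (by simp [xi_real hz])
      exact ⟨z.re, ⟨hz0, hzT, by rw [hzre]; exact hz⟩, hzre⟩
  have hsum : ∑ z ∈ hfin.toFinset, analyticOrderNatAt riemannXiUpper z = hfin.toFinset.card := by
    rw [Finset.card_eq_sum_ones]
    exact Finset.sum_congr rfl fun z hz => xi_simple ((Set.Finite.mem_toFinset _).mp hz).1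
  show S.encard = _
  rw [← Complex.ofReal_injective.encard_image S, himg, hfin.encard_eq_coe_toFinset_card,
    ← sum_analyticOrderNatAt_eq_zetaZeroCount T, hsum]

/-- The constant family `û_t := Ξ` satisfies SC-3 (with `δ = 1/4`, `α = β = 0`). -/
theorem thinConvergence_const_xi : ThinConvergence (fun _ => riemannXiUpper) := by
  refine ⟨1 / 4, by norm_num, by norm_num, fun _ => 0, fun _ => 0, fun T _ => ?_⟩
  have : (fun (_ : ℝ) (z : ℂ) => Complex.exp (-((0 : ℝ) : ℂ) - ((0 : ℝ) : ℂ) * z ^ 2) * riemannXiUpper z)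
      = fun _ => riemannXiUpper := by
    funext t z; simp
  rw [this]
  intro u hu
  exact Eventually.of_forall fun _ x _ => refl_mem_uniformity hu

/-- **PLACEMENT of ROUTE R-K.** The existential form of the criterion — «some family of entire,
real-on-`ℝ`, even functions satisfies SC-2 ∧ SC-3» — is implied by `RH ∧ SimpleZerosConjecture`
(witness: the constant family `Ξ`) and implies `RH` (G22-T). -/
theorem exists_countLaw_and_thinConvergence_of_riemannHypothesis (hRH : RiemannHypothesis)
    (hS : SimpleZerosConjecture) :
    ∃ F : ℝ → ℂ → ℂ, (∀ t, Differentiable ℂ (F t)) ∧ (∀ (t : ℝ) (x : ℝ), (F t x).im = 0) ∧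
      (∀ (t : ℝ) (z : ℂ), F t (-z) = F t z) ∧ CountLaw F ∧ ThinConvergence F :=
  ⟨fun _ => riemannXiUpper, fun _ => differentiable_riemannXiUpper',
    fun _ x => im_riemannXiUpper_ofReal_holds x, fun _ z => riemannXiUpper_neg z,
    countLaw_const_xi hRH hS, thinConvergence_const_xi⟩

/-- The converse direction of the placement: the existential criterion implies RH. -/
theorem riemannHypothesis_of_exists_countLaw_and_thinConvergence
    (h : ∃ F : ℝ → ℂ → ℂ, (∀ t, Differentiable ℂ (F t)) ∧ (∀ (t : ℝ) (x : ℝ), (F t x).im = 0) ∧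
      (∀ (t : ℝ) (z : ℂ), F t (-z) = F t z) ∧ CountLaw F ∧ ThinConvergence F) :
    RiemannHypothesis := by
  obtain ⟨F, hd, hr, he, hC, hT⟩ := h
  exact riemannHypothesis_of_countLaw_of_thinConvergence hd hr he hC hT

/-! ## Given THIN, COUNT off the ordinates is RH (up to simplicity) -/

/-! «SC-2 OFF THE ORDINATES» = the count law at heights `T` that are not ordinates (`∀ z, Ξ z = 0 →
Re z ≠ T`), spelled out below; implied by SC-3 in an RH-world with simple zeros
(`countLaw_offOrdinates_of_riemannHypothesis`), whereas the verbatim `CountLaw` is not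
(`û_t(z) := Ξ((1 - 1/(t+2)) z)` misses the zero at `T = γ`). -/

/-- Non-ordinates are unbounded: above any `T₀` there is a height `T` that is not the real part of a
zero of `Ξ` (the zeros with `T₀ < Re z ≤ T₀ + 1` are finitely many). -/
theorem exists_not_ordinate_ge (T₀ : ℝ) :
    ∃ T : ℝ, T₀ ≤ T ∧ 0 < T ∧ ∀ z : ℂ, riemannXiUpper z = 0 → z.re ≠ T := by
  classical
  set R := max T₀ 1 with hR
  have hfin := xiZeros_finite (R + 1)
  -- the finite set of ordinates in `(0, R+1]` misses some point of the infinite interval `[R, R+1]`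
  set S : Finset ℝ := hfin.toFinset.image Complex.re with hS
  have hinf : (Icc R (R + 1)).Infinite := Icc_infinite (by linarith)
  obtain ⟨T, hT, hTS⟩ := hinf.exists_notMem_finset S
  refine ⟨T, (le_max_left _ _).trans hT.1, lt_of_lt_of_le (lt_of_lt_of_le one_pos (le_max_right _ _)) hT.1,
    fun z hz hzT => hTS ?_⟩
  refine Finset.mem_image.mpr ⟨z, (Set.Finite.mem_toFinset _).mpr ⟨hz, ?_, ?_⟩, hzT⟩
  · rw [hzT]; exact lt_of_lt_of_le (lt_of_lt_of_le one_pos (le_max_right _ _)) hT.1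
  · rw [hzT]; exact hT.2

/-- **G22-T from the off-ordinate count law.** For entire, real-on-`ℝ`, even families: SC-2 at every
non-ordinate height `T > 0` and `ThinConvergence F` imply `RiemannHypothesis`. -/
theorem riemannHypothesis_of_countLaw_offOrdinates_of_thinConvergence {F : ℝ → ℂ → ℂ}
    (hdiff : ∀ t, Differentiable ℂ (F t)) (hreal : ∀ (t : ℝ) (x : ℝ), (F t x).im = 0)
    (heven : ∀ (t : ℝ) (z : ℂ), F t (-z) = F t z)
    (hC : ∀ T : ℝ, 0 < T → (∀ z : ℂ, riemannXiUpper z = 0 → z.re ≠ T) →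
      ∀ᶠ t : ℝ in atTop, (realZeros F t T).encard = (zetaZeroCount T : ℕ∞))
    (hT : ThinConvergence F) : RiemannHypothesis := by
  obtain ⟨δ, hδ, -, α, β, hconv⟩ := hT
  set F' : ℝ → ℂ → ℂ := fun t z => Complex.exp (-(β t : ℂ) * z ^ 2) * F t z with hF'
  have hdiff' : ∀ t, Differentiable ℂ (F' t) := fun t =>
    ((differentiable_const _).mul (differentiable_id.pow 2)).cexp.mul (hdiff t)
  have hreal' : ∀ (t : ℝ) (x : ℝ), (F' t x).im = 0 := by
    intro t x
    have h1 : Complex.exp (-(β t : ℂ) * (x : ℂ) ^ 2) = ((Real.exp (-(β t) * x ^ 2) : ℝ) : ℂ) := by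
      push_cast; ring_nf
    simp only [F', h1, Complex.im_ofReal_mul, hreal t x, mul_zero]
  have heven' : ∀ (t : ℝ) (z : ℂ), F' t (-z) = F' t z := by
    intro t z; simp [F', heven t z]
  have hzeros : ∀ t T, realZeros F' t T = realZeros F t T := by
    intro t T; ext x; simp [F', realZeros, Complex.exp_ne_zero]
  have hconv' : ∀ T : ℝ, 0 < T → TendstoUniformlyOn
      (fun t z => ((Real.exp (-α t) : ℝ) : ℂ) * F' t z) riemannXiUpper atTop (thinRect T δ) := by
    intro T hT
    refine (hconv T hT).congr (Eventually.of_forall fun t z _ => ?_)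
    simp only [F']
    rw [← mul_assoc, Complex.ofReal_exp, ← Complex.exp_add]
    push_cast; ring_nf
  have key : ∀ R : ℝ, ∀ z : ℂ, riemannXiUpper z = 0 → 0 < z.re → z.re ≤ R → z.im = 0 := by
    intro R z hz hz0 hzR
    obtain ⟨T, hTR, hT0, hTord⟩ := exists_not_ordinate_ge R
    exact im_eq_zero_of_count_of_thinRect hdiff' hreal' heven' (c := fun t => Real.exp (-α t))
      (fun t => (Real.exp_pos _).ne') (lt_add_one T) hT0.le hδ
      (by simpa only [hzeros] using hC T hT0 hTord) (hconv' (T + 1) (by linarith)) z hz hz0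
      (hzR.trans hTR)
  refine (riemannHypothesis_iff_im_eq_zero_of_riemannXiUpper_eq_zero_holds :
    RiemannHypothesis ↔ _).mpr fun z hz => ?_
  rcases lt_trichotomy z.re 0 with hre | hre | hre
  · have hz' : riemannXiUpper (-z) = 0 := by rw [riemannXiUpper_neg]; exact hz
    have := key ((-z).re) (-z) hz' (by simp; linarith) le_rfl
    simpa using this
  · exact absurd hre (re_ne_zero_of_riemannXiUpper_eq_zero hz)
  · exact key z.re z hz hre le_rfl

/-- **THE RH-WORLD COLLAPSE** (idea-3 §G22-3 remark (3), kernel form): under `RiemannHypothesis`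
and `SimpleZerosConjecture`, every entire, real-on-`ℝ`, even family with SC-3 satisfies SC-2 at every
non-ordinate height. Together with the previous theorem: GIVEN `ThinConvergence F`, «SC-2 off the
ordinates» is implied by `RH ∧ simple zeros` and implies `RH`. -/
theorem countLaw_offOrdinates_of_riemannHypothesis (hRH : RiemannHypothesis)
    (hS : SimpleZerosConjecture) {F : ℝ → ℂ → ℂ}
    (hdiff : ∀ t, Differentiable ℂ (F t)) (hreal : ∀ (t : ℝ) (x : ℝ), (F t x).im = 0)
    (heven : ∀ (t : ℝ) (z : ℂ), F t (-z) = F t z) (hT : ThinConvergence F) :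
    ∀ T : ℝ, 0 < T → (∀ z : ℂ, riemannXiUpper z = 0 → z.re ≠ T) →
      ∀ᶠ t : ℝ in atTop, (realZeros F t T).encard = (zetaZeroCount T : ℕ∞) := by
  intro T hT0 hTord
  obtain ⟨δ, hδ, -, α, β, hconv⟩ := hT
  set F' : ℝ → ℂ → ℂ := fun t z => Complex.exp (-(β t : ℂ) * z ^ 2) * F t z with hF'
  have hdiff' : ∀ t, Differentiable ℂ (F' t) := fun t =>
    ((differentiable_const _).mul (differentiable_id.pow 2)).cexp.mul (hdiff t)
  have hreal' : ∀ (t : ℝ) (x : ℝ), (F' t x).im = 0 := by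
    intro t x
    have h1 : Complex.exp (-(β t : ℂ) * (x : ℂ) ^ 2) = ((Real.exp (-(β t) * x ^ 2) : ℝ) : ℂ) := by
      push_cast; ring_nf
    simp only [F', h1, Complex.im_ofReal_mul, hreal t x, mul_zero]
  have heven' : ∀ (t : ℝ) (z : ℂ), F' t (-z) = F' t z := by
    intro t z; simp [F', heven t z]
  have hzeros : ∀ t, {x : ℝ | 0 < x ∧ x ≤ T ∧ F' t x = 0} = realZeros F t T := by
    intro t; ext x; simp [F', realZeros, Complex.exp_ne_zero]
  have hconv' : TendstoUniformlyOn (fun t z => ((Real.exp (-α t) : ℝ) : ℂ) * F' t z) riemannXiUpper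
      atTop (Icc 0 (T + 1) ×ℂ Icc (-δ) δ) := by
    refine (hconv (T + 1) (by linarith)).congr (Eventually.of_forall fun t z _ => ?_)
    simp only [F']
    rw [← mul_assoc, Complex.ofReal_exp, ← Complex.exp_add]
    push_cast; ring_nf
  -- reflect the thin rectangle `[0, T+1] × [-δ, δ]` to the open neighbourhood `(-T-1, T+1) × (-δ, δ)`
  set Φ : ℝ → ℂ → ℂ := fun t z => ((Real.exp (-α t) : ℝ) : ℂ) * F' t z with hΦ
  have hΦeven : ∀ t z, Φ t (-z) = Φ t z := fun t z => by simp [Φ, heven' t z]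
  set R : Set ℂ := Icc 0 (T + 1) ×ℂ Icc (-δ) δ with hR
  set U : Set ℂ := Ioo (-(T + 1)) (T + 1) ×ℂ Ioo (-δ) δ with hU
  have hUo : IsOpen U := isOpen_Ioo.reProdIm isOpen_Ioo
  have hseg : ∀ x ∈ Icc (0 : ℝ) T, (x : ℂ) ∈ U := fun x hx =>
    mem_reProdIm.mpr ⟨⟨by simp; linarith [hx.1], by simp; linarith [hx.2]⟩, by simp [hδ], by simp [hδ]⟩
  have h' : TendstoUniformlyOn Φ riemannXiUpper atTop ((fun z : ℂ => -z) ⁻¹' R) := by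
    have := hconv'.comp (fun z : ℂ => -z)
    have hΦ' : (fun t => Φ t ∘ fun z : ℂ => -z) = Φ := by funext t z; exact hΦeven t z
    have hΞ : (riemannXiUpper ∘ fun z : ℂ => -z) = riemannXiUpper := by
      funext z; simp [riemannXiUpper_neg]
    rwa [hΦ', hΞ] at this
  have hRU : TendstoUniformlyOn Φ riemannXiUpper atTop (R ∪ (fun z : ℂ => -z) ⁻¹' R) := by
    intro u hu
    filter_upwards [hconv' u hu, h' u hu] with n hn hn' x hx
    exact hx.elim (hn x) (hn' x)
  have hloc : TendstoLocallyUniformlyOn Φ riemannXiUpper atTop U := by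
    refine (hRU.mono ?_).tendstoLocallyUniformlyOn
    intro z hz
    obtain ⟨⟨hr1, hr2⟩, hi1, hi2⟩ := mem_reProdIm.mp hz
    rcases le_or_gt 0 z.re with hre | hre
    · exact Or.inl (mem_reProdIm.mpr ⟨⟨hre, hr2.le⟩, hi1.le, hi2.le⟩)
    · exact Or.inr (mem_reProdIm.mpr
        ⟨⟨by simp; exact hre.le, by simp; linarith⟩, by simp; linarith, by simp; linarith⟩)
  have := count_of_nhds_of_riemannHypothesis hRH hS hdiff' hreal' (c := fun t => Real.exp (-α t))
    (fun t => (Real.exp_pos _).ne') hTord hUo hseg hloc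
  simpa only [hzeros] using this

/-! Axiom census (expected `propext`, `Classical.choice`, `Quot.sound`). -/
#print axioms riemannHypothesis_of_countLaw_of_thinConvergence
#print axioms countLaw_offOrdinates_of_riemannHypothesis

end CountThin

end Summit.RiemannHypothesis.RiemannHypothesis.Theorems

end
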